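import Literature.Analysis.FluidPDE.CurlFreeLiouville
import Literature.Analysis.FluidPDE.HarmonicMeanValue
import HarnessLib

/-!
# Liouville's theorem for harmonic functions of sublinear growth; irrotational incompressible
# fields with vanishing gradient at infinity are constant

Analysis/FluidPDE proofs file (theorems only) on the discharge path of the named fact
`Literature.Analysis.FluidPDE.chaeShvydkoy2013_vorticity_exclusion` (Chae–Shvydkoy, ARMA 209
(2013) = arXiv:1201.6009, Thm 4.1). The printed proof ends: "hence, `ω = 0` on `ℝ^N`. Then there
exists a harmonic function `h` such that `v = ∇h`. By (i) [the strain `½(Dv + Dvᵀ)` tends to `0`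
at infinity], the Hessian matrix `∇²h` is bounded and vanishes at infinity. Since each entry is
harmonic, by the Liouville Theorem, `∇²h = 0`, and therefore `h` is a quadratic polynomial. But,
then from the condition `|∇²h| = o(|y|)` [sic], `h` [i.e. `v`] is constant." For the tree's `C²`
fields the entries of `Dv` are only `C¹`, so instead of Liouville for the (bounded) entries of
`Dv` we apply a Liouville theorem for harmonic functions of SUBLINEAR GROWTH to the components of
`v` itself (`|v(y)| = o(|y|)` follows from `Dv → 0`):

* `InnerProductSpace.HarmonicOnNhd.apply_eq_apply_of_sublinear` — **Liouville, sublinear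
  growth**: a function harmonic on a finite-dimensional real inner product space with
  `|η(x)| ≤ δ‖x‖` for `‖x‖ ≥ R_δ`, for every `δ > 0`, is constant. Proof: the comparison of weighted
  mean values over the balls `B̄(x₀, R)`, `B̄(x₁, R)` of the tree's bounded Liouville theorem
  (`HarmonicOnNhd.apply_eq_apply_of_abs_le`, `BoundedAnnihilator.lean`; Gilbarg–Trudinger
  Thm 2.1 / Evans §2.2.3 (c)) gives `I |η x₀ − η x₁| ≤ 2 V ‖x₀ − x₁‖ R⁻¹ sup_{B̄(x₀,R) ∪ B̄(x₁,R)} |η|`,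
  and the sup is `o(R)`.
* `norm_sub_le_of_fderiv_small` — growth from the gradient: if `‖DU(z)‖ ≤ δ` for `‖z‖ ≥ r` and
  `‖DU‖ ≤ S` everywhere then `‖U y − U 0‖ ≤ S r + δ ‖y‖` (mean value inequality on the two pieces
  of the segment `[0, y]`).
* `eq_of_curl_eq_zero_of_isDivFree_of_fderiv_tendsto_zero` — **a `C²` field on `ℝ³` with
  `curl U = 0`, `div U = 0` and `DU → 0` at infinity is constant** (each component is harmonic by
  the tree's `laplacian_eq_zero_of_curl_eq_zero_of_isDivFree`, and of sublinear growth).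

## References

* D. Chae, R. Shvydkoy, ARMA 209 (2013) = arXiv:1201.6009, §4, proof of Thm 4.1 (last lines).
  [ChaeShvydkoy2013]
* D. Gilbarg, N. S. Trudinger, *Elliptic PDE of Second Order* (2001), Thm 2.1 and the Liouville
  theorem. [GilbargTrudinger2001]

## Mathlib / tree search

`lean search 'apply_eq_apply_of'`: only the bounded version
(`InnerProductSpace.HarmonicOnNhd.apply_eq_apply_of_abs_le`); no polynomial/sublinear-growth
Liouville theorem in the tree or Mathlib (Mathlib's Liouville theorems are complex-analytic).
Reused: `integral_radial_mul_harmonic` (`HarmonicMeanValue`), `contDiff_two_of_harmonicOnNhd_univ`,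
`laplacian_eq_zero_of_curl_eq_zero_of_isDivFree`, `harmonicOnNhd_of_laplacian_eq_zero`
(`CurlFreeLiouville`, `HarmonicLiouvilleLp`); Mathlib `Convex.norm_image_sub_le_of_norm_fderiv_le`,
`Measure.addHaar_real_closedBall'`, `Measure.integral_comp_inv_smul_of_nonneg`.
-/

noncomputable section

open MeasureTheory Set Function Filter Topology InnerProductSpace Metric
open scoped RealInnerProductSpace Laplacian

namespace Literature.Analysis.FluidPDE

variable {E : Type*} [NormedAddCommGroup E] [InnerProductSpace ℝ E] [FiniteDimensional ℝ E]
  [MeasurableSpace E] [BorelSpace E]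

/-! ### Liouville for harmonic functions of sublinear growth -/

/-- **Liouville's theorem for harmonic functions of sublinear growth.** On a finite-dimensional
real inner product space, a function harmonic on all of `E` with `|η(x)| ≤ δ ‖x‖` for all
`‖x‖ ≥ R_δ`, for every `δ > 0`, is constant. (Gilbarg–Trudinger Thm 2.1 and the comparison of mean
values over two large balls, as in the tree's bounded version
`HarmonicOnNhd.apply_eq_apply_of_abs_le`, whose proof this one follows line by line with the
global bound `M` replaced by the supremum over `B̄(x₀,R) ∪ B̄(x₁,R)`, which is `o(R)`.)
[cite: GilbargTrudinger2001, Thm 2.1] -/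
theorem _root_.InnerProductSpace.HarmonicOnNhd.apply_eq_apply_of_sublinear {η : E → ℝ}
    (hη : HarmonicOnNhd η univ)
    (hgrowth : ∀ δ : ℝ, 0 < δ → ∃ Rδ : ℝ, ∀ x : E, Rδ ≤ ‖x‖ → |η x| ≤ δ * ‖x‖)
    (x₀ x₁ : E) : η x₀ = η x₁ := by
  rcases subsingleton_or_nontrivial E with hE | hE
  · rw [Subsingleton.elim x₀ x₁]
  have hηc : Continuous η := (contDiff_two_of_harmonicOnNhd_univ hη).continuous
  -- the cone weight `ρ(x) = max(1 - ‖x‖, 0)`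
  set ρ : E → ℝ := fun x => max (1 - ‖x‖) 0 with hρ_def
  have hρc : Continuous ρ := (continuous_const.sub continuous_norm).max continuous_const
  have hρ0 : ∀ x, 0 ≤ ρ x := fun x => le_max_right _ _
  have hρz : ∀ x : E, 1 ≤ ‖x‖ → ρ x = 0 := fun x hx => max_eq_right (by linarith)
  have hρs : HasCompactSupport ρ := by
    refine HasCompactSupport.intro (isCompact_closedBall (0 : E) 1) fun x hx => hρz x ?_
    rw [mem_closedBall_zero_iff, not_le] at hx
    exact hx.le
  have hρrad : ∀ x y : E, ‖x‖ = ‖y‖ → ρ x = ρ y := fun x y h => by simp [hρ_def, h]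
  have hρi : Integrable ρ volume := hρc.integrable_of_hasCompactSupport hρs
  have hI : 0 < ∫ x, ρ x := by
    rw [integral_pos_iff_support_of_nonneg hρ0 hρi]
    refine hρc.isOpen_support.measure_pos volume ⟨0, ?_⟩
    simp [hρ_def]
  set I := ∫ x, ρ x with hI_def
  have hρlip : ∀ a b : E, |ρ a - ρ b| ≤ ‖a - b‖ := fun a b => by
    calc |ρ a - ρ b| = |max (1 - ‖a‖) 0 - max (1 - ‖b‖) 0| := rfl
      _ ≤ |(1 - ‖a‖) - (1 - ‖b‖)| := abs_max_sub_max_le_abs _ _ _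
      _ = |‖b‖ - ‖a‖| := by ring_nf
      _ ≤ ‖b - a‖ := abs_norm_sub_norm_le b a
      _ = ‖a - b‖ := norm_sub_rev _ _
  set n := Module.finrank ℝ E with hn_def
  -- scaled weights
  set ρR : ℝ → E → ℝ := fun R x => ρ (R⁻¹ • x) with hρR_def
  have hρRc : ∀ R, Continuous (ρR R) := fun R => hρc.comp (continuous_const.smul continuous_id)
  have hρRs : ∀ R, 0 < R → HasCompactSupport (ρR R) := fun R hR =>
    hρs.comp_smul (inv_ne_zero hR.ne')
  have hρRrad : ∀ R (x y : E), ‖x‖ = ‖y‖ → ρR R x = ρR R y := fun R x y h =>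
    hρrad _ _ (by simp [norm_smul, h])
  have hmass : ∀ R, 0 < R → ∫ x, ρR R x = R ^ n * I := fun R hR => by
    have h := Measure.integral_comp_inv_smul_of_nonneg volume ρ hR.le
    simpa [hρR_def, smul_eq_mul] using h
  have hρRlip : ∀ R, 0 < R → ∀ a b : E, |ρR R a - ρR R b| ≤ R⁻¹ * ‖a - b‖ := by
    intro R hR a b
    calc |ρR R a - ρR R b| = |ρ (R⁻¹ • a) - ρ (R⁻¹ • b)| := rfl
      _ ≤ ‖R⁻¹ • a - R⁻¹ • b‖ := hρlip _ _
      _ = R⁻¹ * ‖a - b‖ := by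
        rw [← smul_sub, norm_smul, Real.norm_of_nonneg (inv_nonneg.2 hR.le)]
  have hρRz : ∀ R, 0 < R → ∀ z : E, R ≤ ‖z‖ → ρR R z = 0 := by
    intro R hR z hz
    refine hρz _ ?_
    rw [norm_smul, Real.norm_of_nonneg (inv_nonneg.2 hR.le)]
    rw [← div_eq_inv_mul, le_div_iff₀ hR, one_mul]
    exact hz
  -- volume of balls
  set V : ℝ := (volume : Measure E).real (closedBall (0 : E) 1) with hV_def
  have hV0 : 0 ≤ V := measureReal_nonneg
  have hball : ∀ (x : E) (R : ℝ), 0 < R →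
      (volume : Measure E).real (closedBall x R) = R ^ n * V := fun x R hR =>
    Measure.addHaar_real_closedBall' volume x hR.le
  -- the key estimate for every radius and every bound on the two balls
  have key : ∀ R : ℝ, 0 < R → ∀ M : ℝ, 0 ≤ M →
      (∀ y ∈ closedBall x₀ R ∪ closedBall x₁ R, |η y| ≤ M) →
      I * |η x₀ - η x₁| ≤ 2 * M * V * ‖x₀ - x₁‖ * R⁻¹ := by
    intro R hR M hM0 hM
    have hRn : (0 : ℝ) < R ^ n := pow_pos hR n
    have mvp₀ := integral_radial_mul_harmonic hη (hρRc R) (hρRs R hR) (hρRrad R) x₀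
    have mvp₁ := integral_radial_mul_harmonic hη (hρRc R) (hρRs R hR) (hρRrad R) x₁
    -- translate the weights to the centres
    have shift : ∀ z : E, ∫ y, ρR R (y - z) * η y = ∫ x, ρR R x * η (z + x) := fun z => by
      rw [← integral_sub_right_eq_self (fun x => ρR R x * η (z + x)) z]
      refine integral_congr_ae (ae_of_all _ fun y => ?_)
      simp only [add_sub_cancel]
    -- integrability of the translated products
    have hint : ∀ z : E, Integrable (fun y => ρR R (y - z) * η y) volume := fun z => by
      have hc : Continuous fun y => ρR R (y - z) * η y :=
        ((hρRc R).comp (continuous_id.sub continuous_const)).mul hηc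
      have hs : HasCompactSupport fun y => ρR R (y - z) * η y := by
        refine HasCompactSupport.mul_right ?_
        have h := (hρRs R hR).comp_homeomorph (Homeomorph.addRight (-z))
        have e : (fun y => ρR R (y - z)) = ρR R ∘ (Homeomorph.addRight (-z)) := by
          funext y
          simp [sub_eq_add_neg]
        rw [e]
        exact h
      exact hc.integrable_of_hasCompactSupport hs
    -- the difference of the two mean value identities
    have hdiff : (R ^ n * I) * (η x₀ - η x₁) =
        ∫ y, (ρR R (y - x₀) - ρR R (y - x₁)) * η y := by
      have e : (fun y => (ρR R (y - x₀) - ρR R (y - x₁)) * η y) =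
          fun y => ρR R (y - x₀) * η y - ρR R (y - x₁) * η y := by
        ext y; ring
      rw [e, integral_sub (hint x₀) (hint x₁), shift x₀, shift x₁, mvp₀, mvp₁, hmass R hR]
      ring
    -- the integrand vanishes off `B̄(x₀, R) ∪ B̄(x₁, R)` and is bounded by `R⁻¹ ‖x₀ - x₁‖ M`
    set S : Set E := closedBall x₀ R ∪ closedBall x₁ R with hS
    have hSfin : volume S < (⊤ : ENNReal) :=
      ((isCompact_closedBall x₀ R).union (isCompact_closedBall x₁ R)).measure_lt_top
    have hvanish : ∀ y ∉ S, (ρR R (y - x₀) - ρR R (y - x₁)) * η y = 0 := by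
      intro y hy
      rw [hS, mem_union, not_or, mem_closedBall, mem_closedBall, dist_eq_norm, dist_eq_norm,
        not_le, not_le] at hy
      rw [hρRz R hR _ hy.1.le, hρRz R hR _ hy.2.le, sub_self, zero_mul]
    have hptw : ∀ y ∈ S, ‖(ρR R (y - x₀) - ρR R (y - x₁)) * η y‖ ≤ R⁻¹ * ‖x₀ - x₁‖ * M := by
      intro y hy
      rw [norm_mul, Real.norm_eq_abs, Real.norm_eq_abs]
      have h1 : |ρR R (y - x₀) - ρR R (y - x₁)| ≤ R⁻¹ * ‖x₀ - x₁‖ := by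
        have h := hρRlip R hR (y - x₀) (y - x₁)
        rwa [sub_sub_sub_cancel_left, norm_sub_rev] at h
      exact mul_le_mul h1 (hM y hy) (abs_nonneg _)
        (mul_nonneg (inv_nonneg.2 hR.le) (norm_nonneg _))
    have hmeasS : volume.real S ≤ 2 * (R ^ n * V) := by
      calc volume.real S ≤ volume.real (closedBall x₀ R) + volume.real (closedBall x₁ R) :=
            measureReal_union_le _ _
        _ = 2 * (R ^ n * V) := by rw [hball x₀ R hR, hball x₁ R hR]; ring
    have hnorm : ‖∫ y, (ρR R (y - x₀) - ρR R (y - x₁)) * η y‖ ≤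
        R⁻¹ * ‖x₀ - x₁‖ * M * (2 * (R ^ n * V)) := by
      rw [← setIntegral_eq_integral_of_forall_compl_eq_zero hvanish]
      refine (norm_setIntegral_le_of_norm_le_const hSfin hptw).trans ?_
      exact mul_le_mul_of_nonneg_left hmeasS
        (mul_nonneg (mul_nonneg (inv_nonneg.2 hR.le) (norm_nonneg _)) hM0)
    rw [← hdiff, Real.norm_eq_abs, abs_mul, abs_of_pos (mul_pos hRn hI)] at hnorm
    -- divide by `Rⁿ`
    have h2 : R ^ n * (I * |η x₀ - η x₁|) ≤ R ^ n * (2 * M * V * ‖x₀ - x₁‖ * R⁻¹) := by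
      calc R ^ n * (I * |η x₀ - η x₁|) = R ^ n * I * |η x₀ - η x₁| := by ring
        _ ≤ R⁻¹ * ‖x₀ - x₁‖ * M * (2 * (R ^ n * V)) := hnorm
        _ = R ^ n * (2 * M * V * ‖x₀ - x₁‖ * R⁻¹) := by ring
    exact le_of_mul_le_mul_left h2 hRn
  -- the bound on the two balls from the growth hypothesis: for `R ≥ R_δ`,
  -- `sup_{B̄(x₀,R) ∪ B̄(x₁,R)} |η| ≤ K_δ + δ (‖x₀‖ + ‖x₁‖ + R)`
  have hfinal : ∀ δ : ℝ, 0 < δ → I * |η x₀ - η x₁| ≤ 2 * V * ‖x₀ - x₁‖ * δ := by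
    intro δ hδ
    obtain ⟨Rδ, hRδ⟩ := hgrowth δ hδ
    -- a bound `K` for `|η|` on the compact ball `B̄(0, Rδ)`
    obtain ⟨K, hK⟩ : ∃ K, ∀ y ∈ closedBall (0 : E) Rδ, |η y| ≤ K := by
      obtain ⟨K, hK⟩ := (isCompact_closedBall (0 : E) Rδ).bddAbove_image
        (continuous_abs.comp hηc).continuousOn
      exact ⟨K, fun y hy => hK (Set.mem_image_of_mem _ hy)⟩
    set K' : ℝ := max K 0 with hK'
    have hK'0 : 0 ≤ K' := le_max_right _ _
    -- pointwise growth bound everywhere: `|η y| ≤ K' + δ ‖y‖`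
    have hgr : ∀ y : E, |η y| ≤ K' + δ * ‖y‖ := by
      intro y
      by_cases hy : Rδ ≤ ‖y‖
      · exact (hRδ y hy).trans (by linarith [mul_nonneg hδ.le (norm_nonneg y)])
      · have hyb : y ∈ closedBall (0 : E) Rδ := by
          rw [mem_closedBall_zero_iff]
          exact (not_le.1 hy).le
        calc |η y| ≤ K := hK y hyb
          _ ≤ K' := le_max_left _ _
          _ ≤ K' + δ * ‖y‖ := by linarith [mul_nonneg hδ.le (norm_nonneg y)]
    -- for every `R ≥ 1`: the sup over the two balls is at most `K' + δ(‖x₀‖ + ‖x₁‖ + R)`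
    have hest : ∀ R : ℝ, 1 ≤ R →
        I * |η x₀ - η x₁| ≤
          2 * V * ‖x₀ - x₁‖ * δ + 2 * V * ‖x₀ - x₁‖ * (K' + δ * (‖x₀‖ + ‖x₁‖)) * R⁻¹ := by
      intro R hR1
      have hR : 0 < R := by linarith
      set MR : ℝ := K' + δ * (‖x₀‖ + ‖x₁‖ + R) with hMR
      have hMR0 : 0 ≤ MR := by positivity
      have hMRb : ∀ y ∈ closedBall x₀ R ∪ closedBall x₁ R, |η y| ≤ MR := by
        intro y hy
        have hy' : ‖y‖ ≤ ‖x₀‖ + ‖x₁‖ + R := by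
          rcases hy with hy | hy
          · rw [mem_closedBall, dist_eq_norm] at hy
            calc ‖y‖ = ‖(y - x₀) + x₀‖ := by rw [sub_add_cancel]
              _ ≤ ‖y - x₀‖ + ‖x₀‖ := norm_add_le _ _
              _ ≤ ‖x₀‖ + ‖x₁‖ + R := by linarith [norm_nonneg x₁]
          · rw [mem_closedBall, dist_eq_norm] at hy
            calc ‖y‖ = ‖(y - x₁) + x₁‖ := by rw [sub_add_cancel]
              _ ≤ ‖y - x₁‖ + ‖x₁‖ := norm_add_le _ _
              _ ≤ ‖x₀‖ + ‖x₁‖ + R := by linarith [norm_nonneg x₀]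
        calc |η y| ≤ K' + δ * ‖y‖ := hgr y
          _ ≤ MR := by rw [hMR]; gcongr
      have hk := key R hR MR hMR0 hMRb
      have e : 2 * MR * V * ‖x₀ - x₁‖ * R⁻¹ =
          2 * V * ‖x₀ - x₁‖ * δ + 2 * V * ‖x₀ - x₁‖ * (K' + δ * (‖x₀‖ + ‖x₁‖)) * R⁻¹ := by
        rw [hMR]
        field_simp
        ring
      linarith
    -- let `R → ∞`
    have hlim : Tendsto (fun R : ℝ =>
        2 * V * ‖x₀ - x₁‖ * δ + 2 * V * ‖x₀ - x₁‖ * (K' + δ * (‖x₀‖ + ‖x₁‖)) * R⁻¹)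
        atTop (𝓝 (2 * V * ‖x₀ - x₁‖ * δ)) := by
      have h := (tendsto_inv_atTop_zero.const_mul
        (2 * V * ‖x₀ - x₁‖ * (K' + δ * (‖x₀‖ + ‖x₁‖)))).const_add (2 * V * ‖x₀ - x₁‖ * δ)
      simpa using h
    exact ge_of_tendsto hlim (Filter.eventually_atTop.2 ⟨1, fun R hR => hest R hR⟩)
  -- let `δ → 0`
  have hlimδ : Tendsto (fun δ : ℝ => 2 * V * ‖x₀ - x₁‖ * δ) (𝓝[>] 0) (𝓝 0) := by
    have h : Tendsto (fun δ : ℝ => 2 * V * ‖x₀ - x₁‖ * δ) (𝓝 0) (𝓝 (2 * V * ‖x₀ - x₁‖ * 0)) :=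
      tendsto_const_nhds.mul tendsto_id
    rw [mul_zero] at h
    exact h.mono_left nhdsWithin_le_nhds
  have hle : I * |η x₀ - η x₁| ≤ 0 :=
    ge_of_tendsto hlimδ (eventually_nhdsWithin_of_forall fun δ hδ => hfinal δ hδ)
  have habs0 : |η x₀ - η x₁| ≤ 0 := by
    by_contra h
    exact absurd hle (not_le.2 (mul_pos hI (not_le.1 h)))
  exact sub_eq_zero.1 (abs_nonpos_iff.1 habs0)

/-! ### Growth from the gradient -/

omit [MeasurableSpace E] [BorelSpace E] [FiniteDimensional ℝ E] in
/-- **Sublinear growth from a gradient vanishing at infinity** (the step "`|∇h| = o(|y|)`" of the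
printed proof, quantified): if `U : E → F` is differentiable with `‖DU z‖ ≤ S` for all `z` and
`‖DU z‖ ≤ δ` whenever `r ≤ ‖z‖` (`0 ≤ r`, `0 ≤ δ`), then `‖U y − U 0‖ ≤ S r + δ ‖y‖` for every `y`
(mean value inequality on `[0, t₀ y]` and `[t₀ y, y]`, `t₀ = r/‖y‖`). [cite: ChaeShvydkoy2013, §4, proof of Thm 4.1 (display (4.1) and last paragraph)] -/
theorem norm_sub_le_of_fderiv_small {F : Type*} [NormedAddCommGroup F] [NormedSpace ℝ F]
    {U : E → F} (hU : Differentiable ℝ U) {S δ r : ℝ} (hS : ∀ z, ‖fderiv ℝ U z‖ ≤ S)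
    (hδ : 0 ≤ δ) (hr : 0 ≤ r) (hsmall : ∀ z, r ≤ ‖z‖ → ‖fderiv ℝ U z‖ ≤ δ) (y : E) :
    ‖U y - U 0‖ ≤ S * r + δ * ‖y‖ := by
  have hS0 : 0 ≤ S := (norm_nonneg _).trans (hS 0)
  by_cases hy : ‖y‖ ≤ r
  · -- the whole segment `[0, y]` lies in `B̄(0, r)`: use the global bound
    have h := (convex_segment (0 : E) y).norm_image_sub_le_of_norm_fderiv_le (𝕜 := ℝ)
      (fun z _ => (hU z)) (fun z _ => hS z) (left_mem_segment ℝ 0 y) (right_mem_segment ℝ 0 y)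
    rw [sub_zero] at h
    calc ‖U y - U 0‖ ≤ S * ‖y‖ := h
      _ ≤ S * r := mul_le_mul_of_nonneg_left hy hS0
      _ ≤ S * r + δ * ‖y‖ := by linarith [mul_nonneg hδ (norm_nonneg y)]
  · have hyr : r < ‖y‖ := not_le.1 hy
    have hy0 : 0 < ‖y‖ := hr.trans_lt hyr
    -- the intermediate point `m = (r/‖y‖) y` on the sphere of radius `r`
    set t₀ : ℝ := r / ‖y‖ with ht₀
    have ht₀0 : 0 ≤ t₀ := div_nonneg hr hy0.le
    have ht₀1 : t₀ ≤ 1 := (div_le_one hy0).2 hyr.le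
    set m : E := t₀ • y with hm
    have hm_norm : ‖m‖ = r := by
      rw [hm, norm_smul, Real.norm_of_nonneg ht₀0, ht₀, div_mul_cancel₀ _ hy0.ne']
    -- first piece `[0, m]`: global bound, length `r`
    have h1 : ‖U m - U 0‖ ≤ S * r := by
      have h := (convex_segment (0 : E) m).norm_image_sub_le_of_norm_fderiv_le (𝕜 := ℝ)
        (fun z _ => (hU z)) (fun z _ => hS z) (left_mem_segment ℝ 0 m) (right_mem_segment ℝ 0 m)
      rw [sub_zero, hm_norm] at h
      exact h
    -- second piece `[m, y]`: every point has norm `≥ r`, bound `δ`, length `‖y‖ - r ≤ ‖y‖`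
    have hseg : ∀ z ∈ segment ℝ m y, r ≤ ‖z‖ := by
      intro z hz
      rw [segment_eq_image'] at hz
      obtain ⟨θ, hθ, rfl⟩ := hz
      have hθ0 : 0 ≤ θ := hθ.1
      have hθ1 : θ ≤ 1 := hθ.2
      -- `m + θ (y - m) = (t₀ + θ(1 - t₀)) y`
      have e : m + θ • (y - m) = (t₀ + θ * (1 - t₀)) • y := by
        rw [hm, smul_sub, smul_smul, ← sub_smul, ← add_smul]
        congr 1
        ring
      show r ≤ ‖m + θ • (y - m)‖
      rw [e, norm_smul, Real.norm_of_nonneg (by nlinarith)]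
      calc r = t₀ * ‖y‖ := by rw [ht₀, div_mul_cancel₀ _ hy0.ne']
        _ ≤ (t₀ + θ * (1 - t₀)) * ‖y‖ := by
          apply mul_le_mul_of_nonneg_right _ hy0.le
          nlinarith
    have h2 : ‖U y - U m‖ ≤ δ * ‖y - m‖ :=
      (convex_segment m y).norm_image_sub_le_of_norm_fderiv_le (𝕜 := ℝ)
        (fun z _ => (hU z)) (fun z hz => hsmall z (hseg z hz)) (left_mem_segment ℝ m y)
        (right_mem_segment ℝ m y)
    have hym : ‖y - m‖ ≤ ‖y‖ := by
      have e : y - m = (1 - t₀) • y := by rw [hm, sub_smul, one_smul]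
      rw [e, norm_smul, Real.norm_of_nonneg (by linarith)]
      exact mul_le_of_le_one_left hy0.le (by linarith)
    calc ‖U y - U 0‖ = ‖(U y - U m) + (U m - U 0)‖ := by rw [sub_add_sub_cancel]
      _ ≤ ‖U y - U m‖ + ‖U m - U 0‖ := norm_add_le _ _
      _ ≤ δ * ‖y - m‖ + S * r := add_le_add h2 h1
      _ ≤ δ * ‖y‖ + S * r := by gcongr
      _ = S * r + δ * ‖y‖ := by ring

/-! ### Irrotational incompressible fields with vanishing gradient at infinity -/

/-- **A `C²` field on `ℝ³` with `curl U = 0`, `div U = 0` and `DU → 0` at infinity is constant**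
(the last step of the printed proof of CS13 Thm 4.1: "`ω = 0` on `ℝ^N` … `v = ∇h` … by the
Liouville Theorem … `h` [`v`] is constant"; here via Liouville for the harmonic components of `U`,
which have sublinear growth by `norm_sub_le_of_fderiv_small`). [cite: ChaeShvydkoy2013, §4 Thm 4.1 (proof, last paragraph)] -/
theorem eq_of_curl_eq_zero_of_isDivFree_of_fderiv_tendsto_zero
    {U : EuclideanSpace ℝ (Fin 3) → EuclideanSpace ℝ (Fin 3)} (hU : ContDiff ℝ 2 U)
    (hcurl : ∀ x, curl U x = 0) (hdiv : VectorCalculus.IsDivFree U)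
    (hD : Tendsto (fun y => ‖fderiv ℝ U y‖) (cocompact (EuclideanSpace ℝ (Fin 3))) (𝓝 0))
    (x y : EuclideanSpace ℝ (Fin 3)) : U x = U y := by
  have hΔ := laplacian_eq_zero_of_curl_eq_zero_of_isDivFree hU hcurl hdiv
  have hUd : Differentiable ℝ U := hU.differentiable (by norm_num)
  have hDc : Continuous fun y => ‖fderiv ℝ U y‖ := (hU.continuous_fderiv (by norm_num)).norm
  -- eventual smallness of `‖DU‖` outside large balls
  have hsmall : ∀ δ : ℝ, 0 < δ → ∃ r : ℝ, 0 ≤ r ∧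
      ∀ z : EuclideanSpace ℝ (Fin 3), r ≤ ‖z‖ → ‖fderiv ℝ U z‖ ≤ δ := by
    intro δ hδ
    have hev : {z : EuclideanSpace ℝ (Fin 3) | ‖fderiv ℝ U z‖ ≤ δ} ∈
        cocompact (EuclideanSpace ℝ (Fin 3)) := hD (Iic_mem_nhds hδ)
    obtain ⟨K, hK, hKs⟩ := mem_cocompact.1 hev
    obtain ⟨r, hr0, hKr⟩ := hK.isBounded.subset_closedBall_lt 0 (0 : EuclideanSpace ℝ (Fin 3))
    refine ⟨r + 1, by linarith, fun z hz => ?_⟩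
    have hzK : z ∉ K := fun hzK => by
      have h := hKr hzK
      rw [mem_closedBall, dist_zero_right] at h
      linarith
    exact hKs hzK
  -- a global bound `S` on `‖DU‖`
  obtain ⟨S, hS⟩ : ∃ S : ℝ, ∀ z : EuclideanSpace ℝ (Fin 3), ‖fderiv ℝ U z‖ ≤ S := by
    obtain ⟨r₁, hr₁, h₁⟩ := hsmall 1 one_pos
    obtain ⟨K₁, hK₁⟩ := (isCompact_closedBall (0 : EuclideanSpace ℝ (Fin 3)) r₁).bddAbove_image
      hDc.continuousOn
    refine ⟨max K₁ 1, fun z => ?_⟩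
    by_cases hz : r₁ ≤ ‖z‖
    · exact (h₁ z hz).trans (le_max_right _ _)
    · have hzb : z ∈ closedBall (0 : EuclideanSpace ℝ (Fin 3)) r₁ := by
        rw [mem_closedBall_zero_iff]
        exact (not_le.1 hz).le
      exact (hK₁ (Set.mem_image_of_mem _ hzb)).trans (le_max_left _ _)
  have hS0 : 0 ≤ S := (norm_nonneg _).trans (hS 0)
  -- sublinear growth of `U`: `‖U z‖ ≤ δ ‖z‖` for `‖z‖` large
  have hgrowthU : ∀ δ : ℝ, 0 < δ → ∃ Rδ : ℝ, ∀ z : EuclideanSpace ℝ (Fin 3),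
      Rδ ≤ ‖z‖ → ‖U z‖ ≤ δ * ‖z‖ := by
    intro δ hδ
    obtain ⟨r, hr0, hr⟩ := hsmall (δ / 2) (half_pos hδ)
    refine ⟨(‖U 0‖ + S * r) / (δ / 2), fun z hz => ?_⟩
    have h1 := norm_sub_le_of_fderiv_small hUd hS (half_pos hδ).le hr0 hr z
    have h2 : ‖U 0‖ + S * r ≤ δ / 2 * ‖z‖ := by
      rw [div_le_iff₀ (half_pos hδ)] at hz
      linarith
    calc ‖U z‖ = ‖(U z - U 0) + U 0‖ := by rw [sub_add_cancel]
      _ ≤ ‖U z - U 0‖ + ‖U 0‖ := norm_add_le _ _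
      _ ≤ S * r + δ / 2 * ‖z‖ + ‖U 0‖ := by linarith
      _ ≤ δ * ‖z‖ := by linarith
  -- each coordinate is harmonic of sublinear growth, hence constant
  ext i
  set η : EuclideanSpace ℝ (Fin 3) → ℝ := fun z => U z i with hη
  have hηeq : η = (EuclideanSpace.proj i : EuclideanSpace ℝ (Fin 3) →L[ℝ] ℝ) ∘ U := by
    funext z; rfl
  have hη2 : ContDiff ℝ 2 η := by
    rw [hηeq]; exact (EuclideanSpace.proj i : EuclideanSpace ℝ (Fin 3) →L[ℝ] ℝ).contDiff.comp hU
  have hηΔ : ∀ z, (Δ η) z = 0 := fun z => by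
    rw [hηeq, hU.contDiffAt.laplacian_CLM_comp_left, Function.comp_apply, hΔ z, map_zero]
  have hharm : HarmonicOnNhd η univ := harmonicOnNhd_of_laplacian_eq_zero hη2 hηΔ
  have hgr : ∀ δ : ℝ, 0 < δ → ∃ Rδ : ℝ, ∀ z : EuclideanSpace ℝ (Fin 3),
      Rδ ≤ ‖z‖ → |η z| ≤ δ * ‖z‖ := by
    intro δ hδ
    obtain ⟨Rδ, hRδ⟩ := hgrowthU δ hδ
    refine ⟨Rδ, fun z hz => le_trans ?_ (hRδ z hz)⟩
    simpa [hη, Real.norm_eq_abs] using PiLp.norm_apply_le (U z) i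
  exact hharm.apply_eq_apply_of_sublinear hgr x y

end Literature.Analysis.FluidPDE

end
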